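import Literature.MathematicalPhysics.QuantumFieldTheory.Balaban1983to89.B9Eq375GradDivSplitY
import Literature.MathematicalPhysics.QuantumFieldTheory.Balaban1983to89.B9Cor35GAtCubeLetters
import Literature.MathematicalPhysics.QuantumFieldTheory.Balaban1983to89.B9Cor36CubeCinvAtOne

/-!
# `Balaban1983to89.B9Eq376ProjPieceDictY` — THE DICTIONARY BETWEEN r06's (3.76) LETTERS (`gradLin`, `divLin`, `conjHom`, carrier `(Fin(d+1) × SiteY) × ι`, units `η⁻¹`,
# `η²G′_□`, `η⁻⁴C_□`) AND def-Y'S BOND-SECTOR LETTERS (`gradY`, `divY`, `conj b`, carrier `FBondY × ι`, units `c_f`): the `P₁` word of (3.76)–(3.77) read over the cube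
# blocks transports VERBATIM (same kernel) from r06's carrier to def-Y's, and G-F5's projection piece `projPieceK` SPLITS as first-order part + `P₁` word
# (sub-row G-B9-LETTERS, module M5.1b-G «Cor 3.5∕3.6 for the bond-sector cube letter G_□», FILE G-F5c″)

T. Bałaban, *Propagators for lattice gauge theories in a background field*, Commun. Math. Phys. **99** (1985) 389–434
[`Balaban1985BackgroundPropagators`, "B9"]; [4] = Commun. Math. Phys. **96** (1984) 223–250 [`Balaban1984PropagatorsII`].

statement-level skeleton of published theorems with citation tags; proofs where landed; nothing here is a claim about the
Yang–Mills mass gap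

THE PRINTED LOCUS (verbatim, held `paper:balaban1985-cmp99-background-propagators`, journal page = PDF page + 388; page owner r06).  p. 405 (3.76): *«D_{U′U}R(U′U)D\*_{U′U}
= D_UR(U)D\*_U + (D_{U′U} − D_U)R(U)D\*_U + D_UR(U)(D\*_{U′U} − D\*_U) + (D_{U′U} − D_U)R(U)(D\*_{U′U} − D\*_U) − D_{U′U}P₁(A)D\*_{U′U}»*, `R = I − P` ((3.25) p. 394);
(3.3) p. 390∕391 («∇^η_U = η⁻¹(R(U(x,x+ηe_μ))φ(x+ηe_μ) − φ(x))»), (3.8) p. 392 (`D*`); [4] (2.51) p. 232 (block majorants); p. 409 l. 1–5 (the cube letters `G′_□`, `C_□`).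

WHY THIS FILE (cell `lit-balaban`; module M5.1b-G, p38 g43).  G-F5c′ (`B9Cor35POneAtCubeLetters.cor35_POne_cube`, p655610) delivers print's (3.77) majorant of
`D_Ṽ𝒫_□(Ṽ_□)D*_Ṽ − D₁𝒫_□(1)D*₁` in r06's letters: `conjHom b (gradLin (shiftY i) η⁻¹ (UboxY Ṽ))`, `conjHom b (divLin …)`, the `𝒫̂`-word
`conj b(η²G′_□) ∘ conĵQ′* ∘ conj b(η⁻⁴C_□) ∘ conĵQ′ ∘ conj b(η²G′_□)`, block map `q ↦ blkCubeY q.1.2` on `(Fin(d+1) × SiteY i) × ι`.  G-F5′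
(`cor35_G_cube_of_pieces₂`, p653979) consumes `hPP : PP ≺ κ₁α₁(len²)⁻¹e^{−δd}` over `(toB6 (geoCK i □), blkBK i □)` on `FBondY i × ι` with
`PP = conj b((D_Ṽ(G′Q′*C Q′G′)(Ṽ)D*_Ṽ − D₁(G′Q′*CQ′G′)(1)D*₁)^ℝ)` in def-Y's letters, and `hProj : projPieceK = P⁰ + Σ_ν P¹_ν·DK ν + PP`.  THIS FILE is the dictionary:
(i) def-Y's `D_V` IS r06's `gradLin` at `(T, U, c) = (shiftY i, UboxY V, c_f)` read at `(b.dir, chart b₋)` (def-Y's `gradY_apply_eq_cdS`), `D*_V` IS `divLin` on `bondCompY`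
(`divY_apply_eq_sum_cdsS`); r06's `c = η⁻¹ = |c_f|` differs from `c_f` by a sign that SQUARES AWAY in `D·M·D*`; (ii) the `η`-units of the `𝒫̂`-word cancel (`η²·η⁻⁴·η² = 1`);
(iii) block majorants transport along the carrier bijection `FBondY × ι ≃ (Fin(d+1) × SiteY) × ι`, `(⟨s, κ⟩, j) ↦ ((κ, chart s), j)` ([4] (2.51) is a statement about matrix
entries and blocks, invariant under relabelling); (iv) `R_□ = 1 − 𝒫_□` splits `projPieceK` into G-F5b's first-order part (`conj_gradDiv_one_sub_gradDiv_eq`) plus `PP`.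

WHAT THIS FILE PROVES (THEOREMS + one `def` with body: the carrier bijection `bondRelabelY`; 0 `def … : Prop`, 0 sorry).
* §1 `hasMajorant_of_relabel` (block majorants along a carrier bijection), `bondRelabelY` (+ `_apply`, `_symm_apply`), `coordEquiv_symm_relabel`.
* §2 `divLin_relabel_eq_smul_divY`, `gradLin_apply_eq_smul_gradY`, `coordEquiv_symm_conj`, `coordEquiv_symm_conjHom`, ★ `conj_gradY_comp_divY_apply_eq` (one word, `r² = c_f²`),
  ★★ `hasMajorant_conj_gradMdiv_sub_of_relabel` (the difference of two words transports).
* §3 `pHatWord_eq_conj` (`η`-units cancel), `inv_eta_coe_eq` (`(η : ℂ)⁻¹ = |c_f|`), ★★★ `hasMajorant_projWord_of_POne` (G-F5c′'s conclusion ⟹ G-F5′'s `hPP`, same kernel).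
* §4 ★★ `projPieceK_eq_firstOrder_add_projWord` (G-F5′'s `hProj` with `P⁰ := conj b(P0Y^ℝ)`, `P¹_ν := conj b(P1Y ν^ℝ)`).

HONEST SCOPE.  Finite bookkeeping (charts, coordinates, units) over landed modules; nothing of [B9]'s analysis is asserted.  Count-neutral; no summit ∕ sub-problem statement is proved;
nothing continuum ∕ OS ∕ mass-gap ∕ Clay; NOT a node discharge; YM mass gap NOT proved by any of this (Track A conditional rung).  No `sorry`, no `axiom`, no `… : Prop` fact, no
`instance`, no `notation`.  NEW file; nothing landed is modified.  Cell `lit-balaban`, seat `lit-balaban-p38` gen 43, 2026-08-28; `--supports stmt-QuantumFields-19200`.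
Net new unproved facts: 0.

RELATED IN THE TREE, NOT DUPLICATED (searched 2026-08-28): `B6TranslateTorusV1.hasMajorant_relabel` (same-carrier permutations only; ours crosses carriers), r06
`B9Eq376DerivDict` (r06-side `gradLin` majorants; no def-Y bridge), def-Y `Node00.OpsYNablaBridge` (`gradY_apply_eq_cdS`, `divY_apply_eq_sum_cdsS` USED), p21
`B9Cor36CubeCinvAtOne` (`CinvK`), p33 `B9Cor35GpCubeInputsAtOne` (`GpK`), G-F5 `B9Cor35GAtCubeLetters` (`projPieceK`), G-F5b `B9Eq375GradDivSplitY`.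
-/

noncomputable section

namespace Literature.MathematicalPhysics.QuantumFieldTheory.Balaban1983to89.B9Eq376ProjPieceDictY

open B6KLevelCensusIndexV1 (KIdx kGeo)
open B6Cover236MultiLevelBlocks (cubes)
open B6RandomWalk (HasMajorant BlockSupp)
open B6GlobalChartV1 (PV)
open B9Thm34Ext (toB6)
open B9Eq352DivFormLetters (conj conj_apply conj_sub coordEquiv coordEquiv_symm_apply)
open B9Eq376POneLetters (conjHom conjHom_apply conjHom_comp conjHom_eq_conj gradLin divLin gradLin_apply divLin_apply)
open B9CubeLettersOpsL0 (cubeFamY GpCubeY)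
open B9CubeLettersBondOpsL0 (BlkCubeY QpCubeY QpsCubeY XinvCubeY RCubeY)
open B9Eq360DeltaPrimeACubeY (blkCubeY)
open B9CubeGeometryInputs (geoCK geoCK_eta)
open B9Cor35GpCubeInputsAtOne (GpK eta_ne_zero)
open B9Cor35GCubeInputsAtOne (blkBK DK kGeo_eta)
open B9Cor35GAtCubeLetters (projPieceK conj_add')
open B9Cor36CubeCinvAtOne (CinvK)
open B9Eq375GradDivSplitY (P0Y P1Y conj_gradDiv_one_sub_gradDiv_eq)
open Node00 (SiteY CfgY FBondY SiteParY toKT shiftY UboxY cdS cdsS gradY divY)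
open Node00.OpsYNablaBridge (chartY bondCompY gradY_apply_eq_cdS divY_apply_eq_sum_cdsS)

variable {d ℓ : ℕ} {hd : 1 ≤ d + 1} {hL : Odd (ℓ + 1) ∧ 1 < ℓ + 1} {b₀ b₁ : ℝ}
variable {𝔸 : Type} [NormedRing 𝔸] [NormedAlgebra ℂ 𝔸] [CompleteSpace 𝔸]
variable {ι : Type} [Fintype ι] (b : Module.Basis ι ℝ 𝔸)

/-! ## §1 Block majorants along a carrier bijection; the bond relabelling `(⟨s, κ⟩, j) ↦ ((κ, chart s), j)` -/

section Relabel

variable {g : B9.Geometry} [Fintype g.Site] {Rr : ℝ} {H : Prop} {X X' : Type}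

/-- ★ **[4] (2.51) IS INVARIANT UNDER RELABELLING THE FINE CARRIER**: along a bijection `σ : X ≃ X′` compatible with the block maps, an operator conjugate to one with the
block majorant `K` has the block majorant `K`. [cite: Balaban1984PropagatorsII, (2.51) p.232, dictionary (charts)] -/
theorem hasMajorant_of_relabel (σ : X ≃ X') {blk : X → (toB6 g Rr H).Site} {blk' : X' → (toB6 g Rr H).Site} (hblk : ∀ x, blk' (σ x) = blk x)
    {T : Module.End ℝ (X → ℝ)} {T' : Module.End ℝ (X' → ℝ)} (hT : ∀ μ x, T μ x = T' (μ ∘ σ.symm) (σ x)) {K : g.Site → g.Site → ℝ}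
    (h : HasMajorant (g := toB6 g Rr H) blk' T' K) : HasMajorant (g := toB6 g Rr H) blk T K := by
  intro y' μ B hμ x
  rw [hT, ← hblk]
  refine h y' (μ ∘ σ.symm) B ⟨hμ.nonneg, fun x' hx' => ?_, fun x' hx' => ?_⟩ (σ x)
  · exact hμ.bound (σ.symm x') (by rw [← hblk, Equiv.apply_symm_apply]; exact hx')
  · exact hμ.off (σ.symm x') (by rw [← hblk, Equiv.apply_symm_apply]; exact hx')

end Relabel

section Bond

variable (i : KIdx d ℓ hd hL b₀ b₁)

omit [NormedRing 𝔸] [NormedAlgebra ℂ 𝔸] [CompleteSpace 𝔸] [Fintype ι] in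
/-- **the carrier bijection** `FBondY i × ι ≃ (Fin(d+1) × SiteY i) × ι`, `(⟨s, κ⟩, j) ↦ ((κ, chart s), j)` (def-Y's bonds = (initial point, direction); r06's = (direction, site)).
[cite: Balaban1985BackgroundPropagators, (3.1)–(3.3) p.390, dictionary] -/
def bondRelabelY (ι : Type) : FBondY i × ι ≃ (Fin (d + 1) × SiteY i) × ι where
  toFun p := ((p.1.dir, chartY i p.1.src), p.2)
  invFun q := (⟨(chartY i).symm q.1.2, q.1.1⟩, q.2)
  left_inv p := by
    obtain ⟨⟨s, κ⟩, j⟩ := p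
    simp only [Equiv.symm_apply_apply]
  right_inv q := by
    obtain ⟨⟨κ, z⟩, j⟩ := q
    simp only [Equiv.apply_symm_apply]

omit [NormedRing 𝔸] [NormedAlgebra ℂ 𝔸] [CompleteSpace 𝔸] [Fintype ι] in
/-- `bondRelabelY`, evaluated. [cite: Balaban1985BackgroundPropagators, (3.1) p.390, bookkeeping] -/
@[simp] theorem bondRelabelY_apply (p : FBondY i × ι) : bondRelabelY i ι p = ((p.1.dir, chartY i p.1.src), p.2) := rfl

omit [NormedRing 𝔸] [NormedAlgebra ℂ 𝔸] [CompleteSpace 𝔸] [Fintype ι] in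
/-- `bondRelabelY⁻¹`, evaluated. [cite: Balaban1985BackgroundPropagators, (3.1) p.390, bookkeeping] -/
@[simp] theorem bondRelabelY_symm_apply (q : (Fin (d + 1) × SiteY i) × ι) :
    (bondRelabelY i ι).symm q = (⟨(chartY i).symm q.1.2, q.1.1⟩, q.2) := rfl

omit [CompleteSpace 𝔸] in
/-- the coordinate synthesis commutes with the relabelling: `coord⁻¹(μ ∘ σ⁻¹)(κ, z) = coord⁻¹(μ)(⟨chart⁻¹z, κ⟩)`. [cite: Balaban1984PropagatorsII, (2.51) p.232, bookkeeping] -/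
theorem coordEquiv_symm_relabel (μ : FBondY i × ι → ℝ) :
    (coordEquiv b).symm (μ ∘ (bondRelabelY i ι).symm) = fun p : Fin (d + 1) × SiteY i => (coordEquiv b).symm μ ⟨(chartY i).symm p.2, p.1⟩ := by
  funext p
  rw [coordEquiv_symm_apply, coordEquiv_symm_apply]
  rfl

end Bond

/-! ## §2 def-Y's `D_V`, `D*_V` ARE r06's `gradLin`, `divLin` at `(shiftY i, UboxY V)`; one word; the difference of two words transports -/

section Words

variable (i : KIdx d ℓ hd hL b₀ b₁)

/-- ★ `divLin (shiftY i) c (UboxY V)` on the relabelled bond function IS `(c∕c_f)·D*_V`. [cite: Balaban1985BackgroundPropagators, (3.8) p.392, (3.76) p.405, dictionary] -/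
theorem divLin_relabel_eq_smul_divY (c : ℂ) (V : CfgY 𝔸 i) (F : FBondY i → 𝔸) :
    divLin (shiftY i) c (UboxY i V) (fun p : Fin (d + 1) × SiteY i => F ⟨(chartY i).symm p.2, p.1⟩) = (c * (((i.cf : ℝ) : ℂ))⁻¹) • divY i V F := by
  have hcf : ((i.cf : ℝ) : ℂ) ≠ 0 := Complex.ofReal_ne_zero.2 i.hcf
  funext x
  rw [Pi.smul_apply, divY_apply_eq_sum_cdsS, smul_smul, mul_assoc, inv_mul_cancel₀ hcf, mul_one, divLin_apply]
  rfl

/-- ★ `gradLin (shiftY i) c (UboxY V) Φ` at `(κ, chart s)` IS `(c∕c_f)·(D_VΦ)(⟨s, κ⟩)`. [cite: Balaban1985BackgroundPropagators, (3.3) p.390, (3.76) p.405, dictionary] -/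
theorem gradLin_apply_eq_smul_gradY (c : ℂ) (V : CfgY 𝔸 i) (Φ : SiteY i → 𝔸) (s : Site (PV d ℓ i.m i.K hd hL) 0) (κ : Fin (d + 1)) :
    gradLin (shiftY i) c (UboxY i V) Φ (κ, chartY i s) = (c * (((i.cf : ℝ) : ℂ))⁻¹) • gradY i V Φ ⟨s, κ⟩ := by
  have hcf : ((i.cf : ℝ) : ℂ) ≠ 0 := Complex.ofReal_ne_zero.2 i.hcf
  rw [gradY_apply_eq_cdS, smul_smul, mul_assoc, inv_mul_cancel₀ hcf, mul_one, gradLin_apply]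
  rfl

omit [CompleteSpace 𝔸] in
/-- `coord⁻¹ ∘ conj b T = T ∘ coord⁻¹`. [cite: Balaban1984PropagatorsII, (2.51) p.232, bookkeeping] -/
theorem coordEquiv_symm_conj {S : Type} (T : Module.End ℝ (S → 𝔸)) (ν : S × ι → ℝ) :
    (coordEquiv b).symm (conj b T ν) = T ((coordEquiv b).symm ν) := by
  rw [conj, LinearEquiv.conj_apply_apply, LinearEquiv.symm_apply_apply]

omit [CompleteSpace 𝔸] in
/-- `coord⁻¹ ∘ conjHom b L = L ∘ coord⁻¹`. [cite: Balaban1984PropagatorsII, (2.51) p.232, bookkeeping] -/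
theorem coordEquiv_symm_conjHom {X Y : Type} (L : (X → 𝔸) →ₗ[ℝ] (Y → 𝔸)) (μ : X × ι → ℝ) :
    (coordEquiv b).symm (conjHom b L μ) = L ((coordEquiv b).symm μ) := by
  show (coordEquiv b).symm (coordEquiv b (L ((coordEquiv b).symm μ))) = _
  exact LinearEquiv.symm_apply_apply _ _

/-- ★ **ONE WORD**: for `r² = c_f²` (r06's `r = η⁻¹ = |c_f|`), `conj b((D_V M D*_V)^ℝ) μ (⟨s,κ⟩, j) = (conĵ(gradLin r) ∘ conj b(M^ℝ) ∘ conĵ(divLin r))(μ ∘ σ⁻¹)(((κ, chart s)), j)`.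
[cite: Balaban1985BackgroundPropagators, (3.76) p.405, (3.3) p.390, (3.8) p.392; Balaban1984PropagatorsII, (2.51) p.232, dictionary] -/
theorem conj_gradY_comp_divY_apply_eq (V : CfgY 𝔸 i) (M : (SiteY i → 𝔸) →ₗ[ℂ] (SiteY i → 𝔸)) {r : ℝ} (hr : r ^ 2 = i.cf ^ 2) (μ : FBondY i × ι → ℝ)
    (x : FBondY i × ι) :
    conj b ((gradY i V ∘ₗ M ∘ₗ divY i V).restrictScalars ℝ) μ x =
      (conjHom b (gradLin (shiftY i) ((r : ℝ) : ℂ) (UboxY i V)) ∘ₗ conj b (M.restrictScalars ℝ) ∘ₗ conjHom b (divLin (shiftY i) ((r : ℝ) : ℂ) (UboxY i V)))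
        (μ ∘ (bondRelabelY i ι).symm) (bondRelabelY i ι x) := by
  obtain ⟨⟨s, κ⟩, j⟩ := x
  have ht : ((r : ℝ) : ℂ) * (((i.cf : ℝ) : ℂ))⁻¹ * (((r : ℝ) : ℂ) * (((i.cf : ℝ) : ℂ))⁻¹) = 1 := by
    have h : r * i.cf⁻¹ * (r * i.cf⁻¹) = 1 := by
      rw [show r * i.cf⁻¹ * (r * i.cf⁻¹) = r ^ 2 * (i.cf ^ 2)⁻¹ by ring, hr, mul_inv_cancel₀ (pow_ne_zero 2 i.hcf)]
    exact_mod_cast h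
  rw [conj_apply, bondRelabelY_apply, LinearMap.comp_apply, LinearMap.comp_apply, conjHom_apply, coordEquiv_symm_conj, coordEquiv_symm_conjHom,
    coordEquiv_symm_relabel, divLin_relabel_eq_smul_divY, LinearMap.restrictScalars_apply, LinearMap.restrictScalars_apply, map_smul M]
  dsimp only
  rw [gradLin_apply_eq_smul_gradY, map_smul (gradY i V), Pi.smul_apply, smul_smul, ht, one_smul, LinearMap.comp_apply, LinearMap.comp_apply]

variable {g : B9.Geometry} [Fintype g.Site] {Rr : ℝ} {H : Prop}

/-- ★★ **THE DIFFERENCE OF TWO `D·M·D*` WORDS TRANSPORTS FROM r06's CARRIER TO def-Y's WITH THE SAME KERNEL** (`r² = c_f²`).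
[cite: Balaban1985BackgroundPropagators, (3.76)–(3.77) pp.405–406; Balaban1984PropagatorsII, (2.51) p.232, dictionary] -/
theorem hasMajorant_conj_gradMdiv_sub_of_relabel (blk : SiteY i → (toB6 g Rr H).Site) (V V₁ : CfgY 𝔸 i) (M M₁ : (SiteY i → 𝔸) →ₗ[ℂ] (SiteY i → 𝔸))
    {r : ℝ} (hr : r ^ 2 = i.cf ^ 2) {K : g.Site → g.Site → ℝ}
    (h : HasMajorant (g := toB6 g Rr H) (fun q : (Fin (d + 1) × SiteY i) × ι => blk q.1.2)
      (conjHom b (gradLin (shiftY i) ((r : ℝ) : ℂ) (UboxY i V)) ∘ₗ conj b (M.restrictScalars ℝ) ∘ₗ conjHom b (divLin (shiftY i) ((r : ℝ) : ℂ) (UboxY i V)) -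
        conjHom b (gradLin (shiftY i) ((r : ℝ) : ℂ) (UboxY i V₁)) ∘ₗ conj b (M₁.restrictScalars ℝ) ∘ₗ conjHom b (divLin (shiftY i) ((r : ℝ) : ℂ) (UboxY i V₁))) K) :
    HasMajorant (g := toB6 g Rr H) (fun p : FBondY i × ι => blk (chartY i p.1.src))
      (conj b ((gradY i V ∘ₗ M ∘ₗ divY i V - gradY i V₁ ∘ₗ M₁ ∘ₗ divY i V₁).restrictScalars ℝ)) K := by
  refine hasMajorant_of_relabel (bondRelabelY i ι) (fun p => rfl) (fun μ x => ?_) h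
  have hsub : (gradY i V ∘ₗ M ∘ₗ divY i V - gradY i V₁ ∘ₗ M₁ ∘ₗ divY i V₁).restrictScalars ℝ =
      (gradY i V ∘ₗ M ∘ₗ divY i V).restrictScalars ℝ - (gradY i V₁ ∘ₗ M₁ ∘ₗ divY i V₁).restrictScalars ℝ := LinearMap.ext fun _ => rfl
  rw [hsub, conj_sub, LinearMap.sub_apply, Pi.sub_apply, conj_gradY_comp_divY_apply_eq b i V M hr, conj_gradY_comp_divY_apply_eq b i V₁ M₁ hr,
    LinearMap.sub_apply, Pi.sub_apply]

end Words

/-! ## §3 The `η`-units of the `𝒫̂`-word cancel; G-F5c′'s conclusion ⟹ G-F5′'s `hPP` -/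

section PWord

variable (i : KIdx d ℓ hd hL b₀ b₁) (c : ↥(cubes (toKT i).D.toDomains)) (par : SiteParY 𝔸 i)

/-- ★ **THE `η`-UNITS OF THE PROJECTION WORD CANCEL** (`η²·η⁻⁴·η² = 1`): `conj b(η²G′_□(V)) ∘ conĵQ′_□*(V) ∘ conj b(η⁻⁴C_□(V)) ∘ conĵQ′_□(V) ∘ conj b(η²G′_□(V))
= conj b((G′_□Q′_□*C_□Q′_□G′_□)(V)^ℝ)`. [cite: Balaban1985BackgroundPropagators, (3.25) p.394, p.409 l.1–5; Balaban1984PropagatorsII, (2.51)–(2.52) p.232] -/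
theorem pHatWord_eq_conj (V : CfgY 𝔸 i) :
    conj b (((kGeo i).eta ^ 2) • (GpCubeY i c par V).restrictScalars ℝ) ∘ₗ conjHom b ((QpsCubeY i c par V).restrictScalars ℝ) ∘ₗ
        conj b ((((kGeo i).eta ^ 4)⁻¹) • (XinvCubeY i c par V).restrictScalars ℝ) ∘ₗ conjHom b ((QpCubeY i c par V).restrictScalars ℝ) ∘ₗ
        conj b (((kGeo i).eta ^ 2) • (GpCubeY i c par V).restrictScalars ℝ) =
      conj b ((GpCubeY i c par V ∘ₗ QpsCubeY i c par V ∘ₗ XinvCubeY i c par V ∘ₗ QpCubeY i c par V ∘ₗ GpCubeY i c par V).restrictScalars ℝ) := by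
  have hη : (kGeo i).eta ≠ 0 := eta_ne_zero i
  have h1 : (kGeo i).eta ^ 2 * ((((kGeo i).eta ^ 4)⁻¹) * (kGeo i).eta ^ 2) = 1 := by
    rw [mul_left_comm, ← pow_add, show 2 + 2 = 4 from rfl, inv_mul_cancel₀ (pow_ne_zero 4 hη)]
  rw [← conjHom_eq_conj, ← conjHom_eq_conj, ← conjHom_eq_conj, conjHom_comp, conjHom_comp, conjHom_comp, conjHom_comp]
  congr 1
  refine LinearMap.ext fun Φ => ?_
  simp only [LinearMap.comp_apply, LinearMap.smul_apply, LinearMap.restrictScalars_apply, LinearMap.map_smul_of_tower, smul_smul]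
  rw [h1, one_smul]

/-- r06's derivative unit IS `|c_f|`: `((geoCK i □).η : ℂ)⁻¹ = (|c_f| : ℂ)`, and `|c_f|² = c_f²`. [cite: Balaban1985BackgroundPropagators, (3.3) p.390, (3.39) p.397, bookkeeping] -/
theorem inv_eta_coe_eq : ((((geoCK i c).eta : ℝ) : ℂ))⁻¹ = ((|i.cf| : ℝ) : ℂ) ∧ |i.cf| ^ 2 = i.cf ^ 2 := by
  refine ⟨?_, sq_abs _⟩
  rw [← Complex.ofReal_inv, geoCK_eta, kGeo_eta, inv_inv]

set_option maxRecDepth 16384 in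
/-- ★★★ **G-F5c′'s CONCLUSION ⟹ G-F5′'s `hPP`, SAME KERNEL**: the (3.77) majorant of `conĵ(D_Ṽ)∘𝒫̂_□(Ṽ)∘conĵ(D*_Ṽ) − conĵ(D₁)∘(GpK∘Q̂′*∘CinvK∘Q̂′∘GpK)∘conĵ(D*₁)` over
`(toB6 (geoCK i □) Rr H, q ↦ blkCubeY q.1.2)` gives the same majorant of `conj b((D_Ṽ𝒫_□(Ṽ)D*_Ṽ − D₁𝒫_□(1)D*₁)^ℝ)` over `(toB6 (geoCK i □) Rr H, blkBK i □)`,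
`𝒫_□(V) = G′_□Q′_□*C_□Q′_□G′_□ (V)` (so that `R_□ = 1 − 𝒫_□`). [cite: Balaban1985BackgroundPropagators, (3.76)–(3.77) pp.405–406, (3.25) p.394, Cor. 3.6 p.408; Balaban1984PropagatorsII, (2.51) p.232] -/
theorem hasMajorant_projWord_of_POne (Rr : ℝ) (H : Prop) (V : CfgY 𝔸 i) {K : BlkCubeY i c → BlkCubeY i c → ℝ}
    (h : HasMajorant (g := toB6 (geoCK i c) Rr H) (fun q : (Fin (d + 1) × SiteY i) × ι => blkCubeY i c q.1.2)
      (conjHom b (gradLin (shiftY i) (((geoCK i c).eta : ℂ)⁻¹) (UboxY i V)) ∘ₗ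
          (conj b (((kGeo i).eta ^ 2) • (GpCubeY i c par V).restrictScalars ℝ) ∘ₗ conjHom b ((QpsCubeY i c par V).restrictScalars ℝ) ∘ₗ
            conj b ((((kGeo i).eta ^ 4)⁻¹) • (XinvCubeY i c par V).restrictScalars ℝ) ∘ₗ conjHom b ((QpCubeY i c par V).restrictScalars ℝ) ∘ₗ
            conj b (((kGeo i).eta ^ 2) • (GpCubeY i c par V).restrictScalars ℝ)) ∘ₗ
          conjHom b (divLin (shiftY i) (((geoCK i c).eta : ℂ)⁻¹) (UboxY i V)) -
        conjHom b (gradLin (shiftY i) (((geoCK i c).eta : ℂ)⁻¹) (fun _ _ => (1 : 𝔸ˣ))) ∘ₗ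
          (GpK b i c par ∘ₗ conjHom b ((QpsCubeY i c par (fun _ _ => 1)).restrictScalars ℝ) ∘ₗ CinvK b i c par ∘ₗ
            conjHom b ((QpCubeY i c par (fun _ _ => 1)).restrictScalars ℝ) ∘ₗ GpK b i c par) ∘ₗ
          conjHom b (divLin (shiftY i) (((geoCK i c).eta : ℂ)⁻¹) (fun _ _ => (1 : 𝔸ˣ)))) K) :
    HasMajorant (g := toB6 (geoCK i c) Rr H) (blkBK i c)
      (conj b ((gradY i V ∘ₗ (GpCubeY i c par V ∘ₗ QpsCubeY i c par V ∘ₗ XinvCubeY i c par V ∘ₗ QpCubeY i c par V ∘ₗ GpCubeY i c par V) ∘ₗ divY i V -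
        gradY i (fun _ _ => 1) ∘ₗ (GpCubeY i c par (fun _ _ => 1) ∘ₗ QpsCubeY i c par (fun _ _ => 1) ∘ₗ XinvCubeY i c par (fun _ _ => 1) ∘ₗ
          QpCubeY i c par (fun _ _ => 1) ∘ₗ GpCubeY i c par (fun _ _ => 1)) ∘ₗ divY i (fun _ _ => 1)).restrictScalars ℝ)) K := by
  obtain ⟨hη, hsq⟩ := inv_eta_coe_eq i c
  rw [GpK, CinvK, pHatWord_eq_conj, pHatWord_eq_conj, hη] at h
  exact hasMajorant_conj_gradMdiv_sub_of_relabel b i (g := geoCK i c) (Rr := Rr) (H := H) (blkCubeY i c) V (fun _ _ => 1) _ _ hsq h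

end PWord

/-! ## §4 `R_□ = 1 − 𝒫_□`: the projection piece splits as first-order part + `P₁` word -/

section Split

variable (i : KIdx d ℓ hd hL b₀ b₁) (c : ↥(cubes (toKT i).D.toDomains)) (par : SiteParY 𝔸 i)

/-- `D_U R_□(U) D*_U = D_UD*_U − D_U𝒫_□(U)D*_U` (`R_□ = 1 − 𝒫_□`, (3.25)). [cite: Balaban1985BackgroundPropagators, (3.25) p.394, (3.76) p.405] -/
theorem gradY_RCubeY_divY_eq (U : CfgY 𝔸 i) :
    gradY i U ∘ₗ RCubeY i c par U ∘ₗ divY i U =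
      gradY i U ∘ₗ divY i U - gradY i U ∘ₗ (GpCubeY i c par U ∘ₗ QpsCubeY i c par U ∘ₗ XinvCubeY i c par U ∘ₗ QpCubeY i c par U ∘ₗ GpCubeY i c par U) ∘ₗ divY i U := by
  rw [RCubeY, LinearMap.sub_comp, LinearMap.id_comp, LinearMap.comp_sub]

/-- ★★ **G-F5′'s `hProj`**: `projPieceK b i □ par Ṽ = conj b(P0Y Ṽ^ℝ) + Σ_ν conj b(P1Y Ṽ ν^ℝ)·DK b i ν + conj b((D_Ṽ𝒫_□(Ṽ)D*_Ṽ − D₁𝒫_□(1)D*₁)^ℝ)` — the first-order part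
(G-F5b `conj_gradDiv_one_sub_gradDiv_eq`) plus the `P₁` word. [cite: Balaban1985BackgroundPropagators, (3.74)–(3.76) p.405, (3.25) p.394, (3.82) p.407] -/
theorem projPieceK_eq_firstOrder_add_projWord (V : CfgY 𝔸 i) :
    projPieceK b i c par V =
      conj b ((P0Y i V).restrictScalars ℝ) + ∑ ν, conj b ((P1Y i V ν).restrictScalars ℝ) * DK b i ν +
        conj b ((gradY i V ∘ₗ (GpCubeY i c par V ∘ₗ QpsCubeY i c par V ∘ₗ XinvCubeY i c par V ∘ₗ QpCubeY i c par V ∘ₗ GpCubeY i c par V) ∘ₗ divY i V -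
          gradY i (fun _ _ => 1) ∘ₗ (GpCubeY i c par (fun _ _ => 1) ∘ₗ QpsCubeY i c par (fun _ _ => 1) ∘ₗ XinvCubeY i c par (fun _ _ => 1) ∘ₗ
            QpCubeY i c par (fun _ _ => 1) ∘ₗ GpCubeY i c par (fun _ _ => 1)) ∘ₗ divY i (fun _ _ => 1)).restrictScalars ℝ) := by
  rw [← conj_gradDiv_one_sub_gradDiv_eq, projPieceK, gradY_RCubeY_divY_eq, gradY_RCubeY_divY_eq, ← conj_add']
  congr 1
  refine LinearMap.ext fun X => ?_
  simp only [LinearMap.restrictScalars_apply, LinearMap.add_apply, LinearMap.sub_apply]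
  abel

end Split

end Literature.MathematicalPhysics.QuantumFieldTheory.Balaban1983to89.B9Eq376ProjPieceDictY

end
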